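import Mathlib
import HarnessLib
import Summits.Langlands.Langlands.Theses.CMFreeCompletedClosure
import Literature.NumberTheory.GaloisRepresentations.HeckeDeterminant
import Summits.Langlands.Langlands.Theorems.TorsionGaloisRep.Negative.HypothesisInhabited

/-!
# Birth skeleton (BC3) for crux stmt-Langlands-18471
`Summit.Langlands.Langlands.Theses.CMFreeCompletedClosure.TorsionGaloisRep` — line `birth`

THE CRUX (Scholze's Conjecture I.2 / Calegari–Geraghty Conj. B, characteristic-zero shadow, over a
totally complex field `E` WITHOUT a CM hypothesis): every `𝒪_{ℚ̄_ℓ}`-valued spherical Hecke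
eigensystem `a` occurring in the completed cohomology of the `GL_n/E` tower of a tame level `𝒰`
(`TameLevel.EigensystemOccurs`) admits a continuous semisimple `ρ : Γ_E → GL_n(ℚ̄_ℓ)`, unramified
outside `𝒰.bad`, with `charpoly ρ(Frob_v) = heckeFrobPoly n q_v (a v)` (`IsAssociatedFamily`).

## The line: Hecke determinant → reconstruction (two stubs, the registered birth split)

Every construction of such `ρ` in print (Scholze 2015 Cor. V.4.2–V.4.4 for `E` CM; Harris–Lan–
Taylor–Thorne; Newton–Thorne / Caraiani–Newton refinements) factors through an `n`-dimensional
continuous DETERMINANT (Chenevier) of `Γ_E` with the prescribed Frobenius characteristic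
polynomials, followed by the purely representation-theoretic reconstruction of a semisimple
representation from a determinant over an algebraically closed field (Chenevier 2014, Thm. A /
Thm. 2.12; continuity via Taylor's trace formula; Scholze Def. V.1.8).  The skeleton is exactly that
factorisation, typed over the tree's determinant vocabulary
(`Literature.NumberTheory.GaloisRepresentations.HeckeDeterminant`: `GaloisDeterminant`,
`ChenevierDeterminant.IsContinuous`, `GaloisDeterminant.IsUnramifiedAt`,
`GaloisDeterminant.HasFrobCharpolyAt`):

* `stub_torsion_determinant` (LOAD-BEARING, the open CM-free core; XL): occurrence of `a` ⟹ a
  continuous `n`-dimensional `ℚ̄_ℓ`-valued Galois determinant `D` of `Γ_E`, unramified outside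
  `𝒰.bad`, with `D(X - Frob_v) = heckeFrobPoly n q_v (a v)` for `v ∉ 𝒰.bad`.  Known for `E` CM
  (Scholze Thm. V.4.1 gives determinants valued in `𝕋/J`, `J` nilpotent, at every torsion level;
  the passage to an `𝒪`-valued eigensystem is Chebotarev density + Amitsur/Chenevier uniqueness +
  noetherianity of the universal pseudodeformation ring, Wang-Erickson 2018); open otherwise — no
  Shimura variety realises the completed cohomology of `GL_n/E` for `E` not CM
  (`Literature.Barriers.Langlands.ShimuraVarietyRealizationBarrier`, the route's declared residual).
  Foreseen layer-2 split (NOT filed here — tenure business): (a) torsion-level determinants valued in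
  `𝕋(U_m, 𝒪/ℓ^{t+1})/J` with `J^N = 0`, `N = N(n, [E:ℚ])` uniform (the Scholze V.4.1 shape over
  totally complex `E`), (b) the limit/finiteness step (a) ⟹ this stub.
* `stub_rep_of_determinant` (M–L, TRUE IN PRINT): a continuous `n`-dimensional determinant of `Γ_E`
  over the algebraically closed field `ℚ̄_ℓ`, unramified outside a finite `S` with prescribed
  Frobenius characteristic polynomials `P v`, is `det ∘ ρ` for a continuous semisimple framed
  `ρ : Γ_E → GL_n(ℚ̄_ℓ)` unramified outside `S` with the same Frobenius characteristic polynomials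
  (Chenevier 2014 Thm. A: `D = det ∘ ρ`, `ρ` semisimple, unique up to isomorphism; continuity of `ρ`
  from continuity of `D` by Taylor 1991 §1 / Chenevier Ex. 2.34 in characteristic `0`;
  unramifiedness of `ρ` at `v ∉ S` from `D.IsUnramifiedAt v` through the nondegenerate trace form on
  the semisimple envelope `ℚ̄_ℓ[ρ(Γ_E)]`; Frobenius polynomials by `hasFrobCharpolyAt_ofFramedRep_iff`).
  Natural refinement for a prover: `∃ ρ, IsSemisimple ∧ GroupDeterminant.ofFramedRep ρ = D` plus the
  transfer lemma `IsSemisimple ρ → (ofFramedRep ρ).IsUnramifiedAt v → ρ.IsUnramifiedAt v`.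

Composition `TorsionGaloisRep_of : stub_torsion_determinant → stub_rep_of_determinant →
TorsionGaloisRep` (kernel-checked, no `sorry` outside the two `stub_*`): instantiate the second stub
at `S = 𝒰.bad` (finite by `TameLevel.bad_finite`) and `P v = heckeFrobPoly n q_v (a v)`;
`IsAssociatedFamily` is that conjunction by definition.

Disproof used: no `Disproof.lean` exists for this crux (`ledger crux ls stmt-Langlands-18471`: no
workfiles, 2026-08-17).  Landed Negative lemmas (imported above, refuter birth attack p171234):
`Negative.torsionGaloisRep_hypothesis_inhabited` (the hypothesis `EigensystemOccurs` holds at every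
`(E, n, ℓ, 𝒰)` with `i = 0`, `a = heckeDegree 𝒰` — so neither stub may be vacuous: checked,
`stub_torsion_determinant` must then produce the determinant of `1 ⊕ χ_ℓ ⊕ ⋯ ⊕ χ_ℓ^{n-1}`, which
exists) and `Negative.torsionGaloisRep_rank_zero` (the `n = 0` sector is junk-true; both stubs are
likewise trivially true at `n = 0` and carry their content at `n ≥ 1`).  `ledger negatives --problem
Langlands` checked: no refuted statement of either stub's shape.  No `_false_without_` theorem to
honour.
-/

set_option linter.dupNamespace false
set_option linter.unusedVariables false

noncomputable section

namespace Summit.Langlands.Langlands.Cruxes.TorsionGaloisRep.Birth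

open Summit.Langlands.Langlands.Theses.CMFreeCompletedClosure

/-! ## 1. The stubs -/

/-- **Stub 1 (load-bearing, open CM-free core): the Hecke eigensystem carries a Galois determinant.**
For `E` totally complex, every `𝒪_{ℚ̄_ℓ}`-valued spherical eigensystem `a` occurring in the completed
cohomology of the `GL_n/E` tower of the tame level `𝒰` admits a continuous `n`-dimensional
`ℚ̄_ℓ`-valued determinant `D` of `Γ_E`, unramified outside `𝒰.bad`, with
`D(X - Frob_v) = heckeFrobPoly n q_v (a v)` for every `v ∉ 𝒰.bad`.
Known for `E` CM [cite: Scholze2015, Thm. V.4.1, Cor. V.4.2]; open for `E` totally complex non-CM.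
[conjecture] -/
theorem stub_torsion_determinant :
    ∀ (E : Type) [Field E] [NumberField E], NumberField.IsTotallyComplex E →
      ∀ (n ℓ : ℕ) [Fact ℓ.Prime] (𝒰 : Literature.NumberTheory.Automorphic.BigHeckeGLn.TameLevel n E ℓ)
        (i : ℕ)
        (a : IsDedekindDomain.HeightOneSpectrum (NumberField.RingOfIntegers E) → ℕ →
          (Valued.v : Valuation (PadicAlgCl ℓ) NNReal).valuationSubring),
        𝒰.EigensystemOccurs (Valued.v : Valuation (PadicAlgCl ℓ) NNReal).valuationSubring a i →
          ∃ D : Literature.NumberTheory.GaloisRepresentations.GaloisDeterminant E (PadicAlgCl ℓ) n,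
            Literature.NumberTheory.GaloisRepresentations.ChenevierDeterminant.IsContinuous D ∧
              ∀ v ∉ 𝒰.bad, D.IsUnramifiedAt v ∧ D.HasFrobCharpolyAt v
                (Literature.NumberTheory.Automorphic.BigHeckeGLn.heckeFrobPoly n
                  (Ideal.absNorm v.asIdeal)
                  (fun j => ((a v j : (Valued.v : Valuation (PadicAlgCl ℓ) NNReal).valuationSubring) :
                    PadicAlgCl ℓ))) := by
  sorry

/-- **Stub 2 (true in print): reconstruction of a semisimple representation from a determinant.**
A continuous `n`-dimensional determinant `D` of `Γ_E` over `ℚ̄_ℓ`, unramified outside the finite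
set `S` with Frobenius characteristic polynomials `P v` (`v ∉ S`), comes from a continuous
semisimple framed `ρ : Γ_E → GL_n(ℚ̄_ℓ)` unramified outside `S` with the same Frobenius
characteristic polynomials. [cite: Chenevier2014Determinants, Thm. A, Thm. 2.12, Ex. 2.34]
[cite: Taylor1991GaloisReps, §1, Thm. 1] -/
theorem stub_rep_of_determinant :
    ∀ (E : Type) [Field E] [NumberField E] (n ℓ : ℕ) [Fact ℓ.Prime]
      (S : Set (IsDedekindDomain.HeightOneSpectrum (NumberField.RingOfIntegers E))), S.Finite →
      ∀ (P : IsDedekindDomain.HeightOneSpectrum (NumberField.RingOfIntegers E) →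
          Polynomial (PadicAlgCl ℓ))
        (D : Literature.NumberTheory.GaloisRepresentations.GaloisDeterminant E (PadicAlgCl ℓ) n),
        Literature.NumberTheory.GaloisRepresentations.ChenevierDeterminant.IsContinuous D →
          (∀ v ∉ S, D.IsUnramifiedAt v ∧ D.HasFrobCharpolyAt v (P v)) →
            ∃ ρ : Literature.NumberTheory.GaloisRepresentations.FramedGaloisRep E (PadicAlgCl ℓ) n,
              ρ.toGaloisRep.IsSemisimple ∧ ∀ v ∉ S, ρ.IsUnramifiedAt v ∧ ρ.HasFrobCharpolyAt v (P v) := by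
  sorry

/-! ## 2. The stub statements as named `Prop`s (literally their types) -/

namespace _Goal

/-- The statement of `stub_torsion_determinant`, as a named `Prop` (literally its type). [folklore] -/
def stub_torsion_determinant : Prop :=
  type_of% @Summit.Langlands.Langlands.Cruxes.TorsionGaloisRep.Birth.stub_torsion_determinant

/-- The statement of `stub_rep_of_determinant`, as a named `Prop` (literally its type). [folklore] -/
def stub_rep_of_determinant : Prop :=
  type_of% @Summit.Langlands.Langlands.Cruxes.TorsionGaloisRep.Birth.stub_rep_of_determinant

end _Goal

/-! ## 3. The composition (kernel-checked, no `sorry`) -/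

/-- **`TorsionGaloisRep` from the two stubs.**  The hypotheses are, verbatim, the statements of the
two stubs; the conclusion is the route decl
`Summit.Langlands.Langlands.Theses.CMFreeCompletedClosure.TorsionGaloisRep`, by name: take the
determinant of stub 1, reconstruct `ρ` by stub 2 at `S = 𝒰.bad`, `P v = heckeFrobPoly n q_v (a v)`;
`IsAssociatedFamily` is definitionally the resulting conjunction. [folklore] -/
theorem TorsionGaloisRep_of (h1 : _Goal.stub_torsion_determinant)
    (h2 : _Goal.stub_rep_of_determinant) :
    Summit.Langlands.Langlands.Theses.CMFreeCompletedClosure.TorsionGaloisRep := by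
  unfold _Goal.stub_torsion_determinant at h1
  unfold _Goal.stub_rep_of_determinant at h2
  intro E _ _ hE n ℓ _ 𝒰 i a hocc
  obtain ⟨D, hDc, hD⟩ := h1 E hE n ℓ 𝒰 i a hocc
  obtain ⟨ρ, hss, hρ⟩ := h2 E n ℓ 𝒰.bad 𝒰.bad_finite
    (fun v => Literature.NumberTheory.Automorphic.BigHeckeGLn.heckeFrobPoly n (Ideal.absNorm v.asIdeal)
      (fun j => ((a v j : (Valued.v : Valuation (PadicAlgCl ℓ) NNReal).valuationSubring) :
        PadicAlgCl ℓ)))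
    D hDc hD
  exact ⟨ρ, hss, fun v hv => hρ v hv⟩

/-- The same composition with the stubs plugged in: the crux BY NAME, modulo exactly the two
`sorry`s inside `stub_torsion_determinant` and `stub_rep_of_determinant`. [folklore] -/
theorem TorsionGaloisRep_holds_of_stubs :
    Summit.Langlands.Langlands.Theses.CMFreeCompletedClosure.TorsionGaloisRep :=
  TorsionGaloisRep_of stub_torsion_determinant stub_rep_of_determinant

/-! ## 4. Scratch checks against the landed Negative lemmas (no new content) -/

/-- Non-vacuity check: the hypothesis of stub 1 is inhabited at every `(E, n, ℓ, 𝒰)` (refuter's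
`Negative.torsionGaloisRep_hypothesis_inhabited`), so stub 1 genuinely asserts a determinant there.
[folklore] -/
example {E : Type} [Field E] [NumberField E] {n ℓ : ℕ} [Fact ℓ.Prime]
    (𝒰 : Literature.NumberTheory.Automorphic.BigHeckeGLn.TameLevel n E ℓ) :
    𝒰.EigensystemOccurs (Valued.v : Valuation (PadicAlgCl ℓ) NNReal).valuationSubring
      (fun v j => ((Summit.Langlands.Langlands.Theorems.TorsionGaloisRep.Negative.heckeDegree 𝒰 v j : ℕ) :
        (Valued.v : Valuation (PadicAlgCl ℓ) NNReal).valuationSubring)) 0 :=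
  Summit.Langlands.Langlands.Theorems.TorsionGaloisRep.Negative.torsionGaloisRep_hypothesis_inhabited 𝒰

end Summit.Langlands.Langlands.Cruxes.TorsionGaloisRep.Birth

end
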